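import Summits.QuantumFields.YangMills.Theorems.ColdStartUniversalityLatticeLangevinWilsonDetailedBalance
import Summits.QuantumFields.YangMills.Theorems.ColdStartUniversalityLatticeLangevinWilsonGeneratorPoincare
import Summits.QuantumFields.YangMills.Theorems.ColdStartUniversalityEntropyFlowTools
import HarnessLib

/-!
# Route `ColdStartUniversality` (fixed-cut-off package, entropy side): ENTROPY PRODUCTION of the SZZ semigroup at scale `h` —
# `Ent_μ(κ_h u) − Ent_μ(u) ≤ −4h·𝓔_h(√u) + ‖κ_h u − u‖²_∞ / inf u`

Helper file (seat `ym-line-csu-p1`, g21; `--supports stmt-QuantumFields-27363`).  For the SU(2) lattice Langevin dynamics of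
Shen–Zhu–Zhu at `(L, β')`, `μ = μ_{β'}` the Wilson measure, ANY realising kernel family `κ`, and the scale-`h` Dirichlet form
`h𝓔_h(G) = ∫ G² dμ − ∫ G κ_hG dμ` of the `L²` package (g17/g18):

* `integral_mul_sub_mul_transition_eq_half` — the DOUBLE-INTEGRAL FORM `∫ ab dμ − ∫ b·κ_h a dμ = ½ ∫∫ (a(x) − a(y))(b(x) − b(y))
  κ_h(x,dy) μ(dx)` for continuous `a, b` (detailed balance `(μ ⊗ κ_h)∘swap = μ ⊗ κ_h`, `map_swap_compProd_transitionKernel`);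
* ★ `four_mul_dirichletScale_sqrt_le` — `4(∫ u dμ − ∫ √u κ_h√u dμ) ≤ ∫ u log u dμ − ∫ log u · κ_h u dμ` for continuous `u > 0`
  (the pointwise `4(√a − √b)² ≤ (a − b)(log a − log b)`): the entropy production dominates the energy of `√u`, BGL (5.2.3) in the
  symmetric-kernel form;
* ★ `entropy_transition_sub_entropy_le` — GIBBS: `Ent_μ(κ_h u) − Ent_μ(u) ≤ ∫ (κ_h u − u) log(κ_h u) dμ` (invariance of `μ`);
* ★★ `entropy_transition_sub_entropy_le_dirichletScale` — THE SCALE-`h` ENTROPY PRODUCTION INEQUALITY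
  `Ent_μ(κ_h u) − Ent_μ(u) ≤ −4(∫ u dμ − ∫ √u κ_h√u dμ) + D²/δ` whenever `δ ≤ u` and `|κ_h u − u| ≤ D` (log is `δ⁻¹`-Lipschitz on
  `[δ, ∞)`); divided by `h` and read along `u = κ_t F` (`D = h·sup|𝓛F|`) this is `d⁺/dt Ent(κ_t F) ≤ −4 𝓔(√κ_t F)` (sequel
  `…WilsonEntropyDecay`).

THEOREMS ONLY, no definition, no sorry.  HONEST FRAMING: RECORD-rung R3 plumbing at FIXED cut-off; nothing K-uniform is proved;
no crux, rung or summit statement is proved; the Yang–Mills mass gap is NOT proved.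
-/

set_option autoImplicit false

noncomputable section

namespace Summit.QuantumFields.YangMills.Theorems.ColdStartUniversality

open MeasureTheory ProbabilityTheory Filter Set Topology
open scoped BigOperators NNReal ENNReal
open Literature.Probability.Process Literature.MathematicalPhysics.QuantumFieldTheory
open Literature.MathematicalPhysics.QuantumLattice (fundamentalRep fundamentalLatticeRep continuous_fundamentalRep)

variable {L : ℕ} [NeZero L]

/-! ## §1. The double-integral form of the scale-`h` Dirichlet form -/

/-- **Double-integral form of the scale-`h` form**: for continuous `a, b` and any realising kernel family,
`∫ a b dμ_{β'} − ∫ b · κ_h a dμ_{β'} = ½ ∫ (a(x) − a(y))(b(x) − b(y)) d(μ_{β'} ⊗ κ_h)(x,y)` — detailed balance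
`(μ ⊗ κ_h)∘swap = μ ⊗ κ_h` applied to `a(x)b(y)` and `a(y)b(y)`. [cite: BakryGentilLedoux2014, §1.7 (reversible kernels)] -/
theorem integral_mul_sub_mul_transition_eq_half (L : ℕ) [NeZero L] (β' : ℝ)
    (κ : ℝ≥0 → Kernel (GaugeConfig 3 L (Matrix.specialUnitaryGroup (Fin 2) ℂ))
      (GaugeConfig 3 L (Matrix.specialUnitaryGroup (Fin 2) ℂ))) [∀ t, IsMarkovKernel (κ t)]
    (hreal : ∀ (t : ℝ≥0) (x : GaugeConfig 3 L (Matrix.specialUnitaryGroup (Fin 2) ℂ))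
        (Ω : Type) [MeasurableSpace Ω] (P : Measure Ω) [IsProbabilityMeasure P]
        (W : ℝ≥0 → Ω → (Edge 3 L × NoiseIdx 2 → ℝ)) (hW : IsFlatBrownian W P)
        (U : ℝ≥0 → Ω → GaugeConfig 3 L (Matrix.specialUnitaryGroup (Fin 2) ℂ)),
        (∀ ω, U 0 ω = x) →
        (latticeLangevinDynamics (fundamentalLatticeRep 2) β').IsSolution (fundamentalRep (Fin 2))
          hW.natFiltration P W U →
        κ t x = P.map (U t))
    (h : ℝ≥0) {a b : GaugeConfig 3 L (Matrix.specialUnitaryGroup (Fin 2) ℂ) → ℝ} (ha : Continuous a) (hb : Continuous b) :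
    (∫ x, a x * b x ∂(wilsonMeasure (d := 3) (L := L) (fundamentalRep (Fin 2)) β')) -
        ∫ x, b x * (∫ y, a y ∂(κ h x)) ∂(wilsonMeasure (d := 3) (L := L) (fundamentalRep (Fin 2)) β') =
      (1 / 2 : ℝ) * ∫ p, (a p.1 - a p.2) * (b p.1 - b p.2)
        ∂((wilsonMeasure (d := 3) (L := L) (fundamentalRep (Fin 2)) β') ⊗ₘ κ h) := by
  classical
  haveI := secondCountableTopology_su2
  haveI := borelSpace_config L
  set μ : Measure (GaugeConfig 3 L (Matrix.specialUnitaryGroup (Fin 2) ℂ)) :=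
    wilsonMeasure (d := 3) (L := L) (fundamentalRep (Fin 2)) β' with hμ
  haveI : IsProbabilityMeasure μ :=
    isProbabilityMeasure_wilsonMeasure (d := 3) (L := L) (fundamentalRep (Fin 2)) (continuous_fundamentalRep (Fin 2)) β'
  haveI : IsProbabilityMeasure (μ ⊗ₘ κ h) := by infer_instance
  obtain ⟨Ma, -, hMa⟩ := exists_abs_le_of_continuous ha
  obtain ⟨Mb, -, hMb⟩ := exists_abs_le_of_continuous hb
  -- bounded continuous functions of `(x, y)` are integrable for the probability measure `μ ⊗ κ_h`
  have hint : ∀ {f : GaugeConfig 3 L (Matrix.specialUnitaryGroup (Fin 2) ℂ) × GaugeConfig 3 L (Matrix.specialUnitaryGroup (Fin 2) ℂ) → ℝ},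
      Continuous f → (∃ M : ℝ, ∀ p, |f p| ≤ M) → Integrable f (μ ⊗ₘ κ h) := by
    intro f hf hM
    obtain ⟨M, hM⟩ := hM
    exact Integrable.of_bound hf.measurable.aestronglyMeasurable M
      (ae_of_all _ fun p => by rw [Real.norm_eq_abs]; exact hM p)
  -- the four pieces `a(x)b(x)`, `a(y)b(y)`, `a(y)b(x)`, `a(x)b(y)` as integrals against `μ ⊗ κ_h`
  have hc11 : Continuous fun p : GaugeConfig 3 L (Matrix.specialUnitaryGroup (Fin 2) ℂ) ×
      GaugeConfig 3 L (Matrix.specialUnitaryGroup (Fin 2) ℂ) => a p.1 * b p.1 :=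
    (ha.comp continuous_fst).mul (hb.comp continuous_fst)
  have hc22 : Continuous fun p : GaugeConfig 3 L (Matrix.specialUnitaryGroup (Fin 2) ℂ) ×
      GaugeConfig 3 L (Matrix.specialUnitaryGroup (Fin 2) ℂ) => a p.2 * b p.2 :=
    (ha.comp continuous_snd).mul (hb.comp continuous_snd)
  have hc21 : Continuous fun p : GaugeConfig 3 L (Matrix.specialUnitaryGroup (Fin 2) ℂ) ×
      GaugeConfig 3 L (Matrix.specialUnitaryGroup (Fin 2) ℂ) => a p.2 * b p.1 :=
    (ha.comp continuous_snd).mul (hb.comp continuous_fst)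
  have hc12 : Continuous fun p : GaugeConfig 3 L (Matrix.specialUnitaryGroup (Fin 2) ℂ) ×
      GaugeConfig 3 L (Matrix.specialUnitaryGroup (Fin 2) ℂ) => a p.1 * b p.2 :=
    (ha.comp continuous_fst).mul (hb.comp continuous_snd)
  have hb11 : ∃ M : ℝ, ∀ p : GaugeConfig 3 L (Matrix.specialUnitaryGroup (Fin 2) ℂ) ×
      GaugeConfig 3 L (Matrix.specialUnitaryGroup (Fin 2) ℂ), |a p.1 * b p.1| ≤ M :=
    ⟨Ma * Mb, fun p => by rw [abs_mul]; exact mul_le_mul (hMa p.1) (hMb p.1) (abs_nonneg _) ((abs_nonneg _).trans (hMa p.1))⟩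
  have hb22 : ∃ M : ℝ, ∀ p : GaugeConfig 3 L (Matrix.specialUnitaryGroup (Fin 2) ℂ) ×
      GaugeConfig 3 L (Matrix.specialUnitaryGroup (Fin 2) ℂ), |a p.2 * b p.2| ≤ M :=
    ⟨Ma * Mb, fun p => by rw [abs_mul]; exact mul_le_mul (hMa p.2) (hMb p.2) (abs_nonneg _) ((abs_nonneg _).trans (hMa p.2))⟩
  have hb21 : ∃ M : ℝ, ∀ p : GaugeConfig 3 L (Matrix.specialUnitaryGroup (Fin 2) ℂ) ×
      GaugeConfig 3 L (Matrix.specialUnitaryGroup (Fin 2) ℂ), |a p.2 * b p.1| ≤ M :=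
    ⟨Ma * Mb, fun p => by rw [abs_mul]; exact mul_le_mul (hMa p.2) (hMb p.1) (abs_nonneg _) ((abs_nonneg _).trans (hMa p.2))⟩
  have hb12 : ∃ M : ℝ, ∀ p : GaugeConfig 3 L (Matrix.specialUnitaryGroup (Fin 2) ℂ) ×
      GaugeConfig 3 L (Matrix.specialUnitaryGroup (Fin 2) ℂ), |a p.1 * b p.2| ≤ M :=
    ⟨Ma * Mb, fun p => by rw [abs_mul]; exact mul_le_mul (hMa p.1) (hMb p.2) (abs_nonneg _) ((abs_nonneg _).trans (hMa p.1))⟩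
  have i11 := hint hc11 hb11
  have i22 := hint hc22 hb22
  have i21 := hint hc21 hb21
  have i12 := hint hc12 hb12
  -- swap invariance (detailed balance)
  have hswap := map_swap_compProd_transitionKernel L β' κ hreal h
  have hsw : ∀ {f : GaugeConfig 3 L (Matrix.specialUnitaryGroup (Fin 2) ℂ) × GaugeConfig 3 L (Matrix.specialUnitaryGroup (Fin 2) ℂ) → ℝ},
      Continuous f → ∫ p, f p.swap ∂(μ ⊗ₘ κ h) = ∫ p, f p ∂(μ ⊗ₘ κ h) := by
    intro f hf
    have e := integral_map (μ := μ ⊗ₘ κ h) measurable_swap.aemeasurable (f := f)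
      (hf.measurable.aestronglyMeasurable)
    rw [hswap] at e
    exact e.symm
  have e22 : ∫ p, a p.2 * b p.2 ∂(μ ⊗ₘ κ h) = ∫ p, a p.1 * b p.1 ∂(μ ⊗ₘ κ h) := hsw hc11
  have e12 : ∫ p, a p.1 * b p.2 ∂(μ ⊗ₘ κ h) = ∫ p, a p.2 * b p.1 ∂(μ ⊗ₘ κ h) := hsw hc21
  -- `∫ ab dμ = ∫∫ a(x)b(x)` and `∫ b κ_h a dμ = ∫∫ a(y) b(x)`
  have e11 : ∫ p, a p.1 * b p.1 ∂(μ ⊗ₘ κ h) = ∫ x, a x * b x ∂μ := by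
    rw [Measure.integral_compProd i11]
    refine integral_congr_ae (Eventually.of_forall fun x => ?_)
    simp only [integral_const, one_smul, probReal_univ]
  have e21 : ∫ p, a p.2 * b p.1 ∂(μ ⊗ₘ κ h) = ∫ x, b x * (∫ y, a y ∂(κ h x)) ∂μ := by
    rw [Measure.integral_compProd i21]
    refine integral_congr_ae (Eventually.of_forall fun x => ?_)
    simp only []
    rw [mul_comm (b x), ← integral_mul_const]
  -- expand the product
  have hexp : ∫ p, (a p.1 - a p.2) * (b p.1 - b p.2) ∂(μ ⊗ₘ κ h) =
      ((∫ p, a p.1 * b p.1 ∂(μ ⊗ₘ κ h)) - ∫ p, a p.1 * b p.2 ∂(μ ⊗ₘ κ h)) -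
        ((∫ p, a p.2 * b p.1 ∂(μ ⊗ₘ κ h)) - ∫ p, a p.2 * b p.2 ∂(μ ⊗ₘ κ h)) := by
    have ee : ∀ p : GaugeConfig 3 L (Matrix.specialUnitaryGroup (Fin 2) ℂ) × GaugeConfig 3 L (Matrix.specialUnitaryGroup (Fin 2) ℂ),
        (a p.1 - a p.2) * (b p.1 - b p.2) = (a p.1 * b p.1 - a p.1 * b p.2) - (a p.2 * b p.1 - a p.2 * b p.2) := fun p => by ring
    simp_rw [ee]
    have j1 : Integrable (fun p : GaugeConfig 3 L (Matrix.specialUnitaryGroup (Fin 2) ℂ) ×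
        GaugeConfig 3 L (Matrix.specialUnitaryGroup (Fin 2) ℂ) => a p.1 * b p.1 - a p.1 * b p.2) (μ ⊗ₘ κ h) := i11.sub i12
    have j2 : Integrable (fun p : GaugeConfig 3 L (Matrix.specialUnitaryGroup (Fin 2) ℂ) ×
        GaugeConfig 3 L (Matrix.specialUnitaryGroup (Fin 2) ℂ) => a p.2 * b p.1 - a p.2 * b p.2) (μ ⊗ₘ κ h) := i21.sub i22
    rw [integral_sub j1 j2, integral_sub i11 i12, integral_sub i21 i22]
  rw [hexp, e22, e12, e11, e21]
  ring

/-! ## §2. The entropy production dominates the energy of `√u` -/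

/-- ★ **`4 h𝓔_h(√u) ≤ ∫ u log u dμ − ∫ log u · κ_h u dμ`** for continuous `u > 0`: in the double-integral form both sides are
integrals against `μ_{β'} ⊗ κ_h` of `4(√u(x) − √u(y))² ≤ (u(x) − u(y))(log u(x) − log u(y))`.
[cite: BakryGentilLedoux2014, Thm 5.2.1 (proof) and (5.2.3)] -/
theorem four_mul_dirichletScale_sqrt_le (L : ℕ) [NeZero L] (β' : ℝ)
    (κ : ℝ≥0 → Kernel (GaugeConfig 3 L (Matrix.specialUnitaryGroup (Fin 2) ℂ))
      (GaugeConfig 3 L (Matrix.specialUnitaryGroup (Fin 2) ℂ))) [∀ t, IsMarkovKernel (κ t)]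
    (hreal : ∀ (t : ℝ≥0) (x : GaugeConfig 3 L (Matrix.specialUnitaryGroup (Fin 2) ℂ))
        (Ω : Type) [MeasurableSpace Ω] (P : Measure Ω) [IsProbabilityMeasure P]
        (W : ℝ≥0 → Ω → (Edge 3 L × NoiseIdx 2 → ℝ)) (hW : IsFlatBrownian W P)
        (U : ℝ≥0 → Ω → GaugeConfig 3 L (Matrix.specialUnitaryGroup (Fin 2) ℂ)),
        (∀ ω, U 0 ω = x) →
        (latticeLangevinDynamics (fundamentalLatticeRep 2) β').IsSolution (fundamentalRep (Fin 2))
          hW.natFiltration P W U →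
        κ t x = P.map (U t))
    (h : ℝ≥0) {u : GaugeConfig 3 L (Matrix.specialUnitaryGroup (Fin 2) ℂ) → ℝ} (hu : Continuous u) (hpos : ∀ x, 0 < u x) :
    4 * ((∫ x, Real.sqrt (u x) * Real.sqrt (u x) ∂(wilsonMeasure (d := 3) (L := L) (fundamentalRep (Fin 2)) β')) -
        ∫ x, Real.sqrt (u x) * (∫ y, Real.sqrt (u y) ∂(κ h x)) ∂(wilsonMeasure (d := 3) (L := L) (fundamentalRep (Fin 2)) β')) ≤
      (∫ x, u x * Real.log (u x) ∂(wilsonMeasure (d := 3) (L := L) (fundamentalRep (Fin 2)) β')) -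
        ∫ x, Real.log (u x) * (∫ y, u y ∂(κ h x)) ∂(wilsonMeasure (d := 3) (L := L) (fundamentalRep (Fin 2)) β') := by
  classical
  haveI := secondCountableTopology_su2
  haveI := borelSpace_config L
  set μ : Measure (GaugeConfig 3 L (Matrix.specialUnitaryGroup (Fin 2) ℂ)) :=
    wilsonMeasure (d := 3) (L := L) (fundamentalRep (Fin 2)) β' with hμ
  haveI : IsProbabilityMeasure μ :=
    isProbabilityMeasure_wilsonMeasure (d := 3) (L := L) (fundamentalRep (Fin 2)) (continuous_fundamentalRep (Fin 2)) β'
  haveI : IsProbabilityMeasure (μ ⊗ₘ κ h) := by infer_instance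
  have hsq : Continuous fun x => Real.sqrt (u x) := Real.continuous_sqrt.comp hu
  have hlog : Continuous fun x => Real.log (u x) := hu.log fun x => (hpos x).ne'
  rw [integral_mul_sub_mul_transition_eq_half L β' κ hreal h hsq hsq,
    integral_mul_sub_mul_transition_eq_half L β' κ hreal h hu hlog]
  -- compare the integrands
  obtain ⟨Ms, -, hMs⟩ := exists_abs_le_of_continuous hsq
  obtain ⟨Mu, -, hMu⟩ := exists_abs_le_of_continuous hu
  obtain ⟨Ml, -, hMl⟩ := exists_abs_le_of_continuous hlog
  have hcs : Continuous fun p : GaugeConfig 3 L (Matrix.specialUnitaryGroup (Fin 2) ℂ) ×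
      GaugeConfig 3 L (Matrix.specialUnitaryGroup (Fin 2) ℂ) =>
      (Real.sqrt (u p.1) - Real.sqrt (u p.2)) * (Real.sqrt (u p.1) - Real.sqrt (u p.2)) :=
    ((hsq.comp continuous_fst).sub (hsq.comp continuous_snd)).mul ((hsq.comp continuous_fst).sub (hsq.comp continuous_snd))
  have hcl : Continuous fun p : GaugeConfig 3 L (Matrix.specialUnitaryGroup (Fin 2) ℂ) ×
      GaugeConfig 3 L (Matrix.specialUnitaryGroup (Fin 2) ℂ) => (u p.1 - u p.2) * (Real.log (u p.1) - Real.log (u p.2)) :=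
    ((hu.comp continuous_fst).sub (hu.comp continuous_snd)).mul ((hlog.comp continuous_fst).sub (hlog.comp continuous_snd))
  have his : Integrable (fun p : GaugeConfig 3 L (Matrix.specialUnitaryGroup (Fin 2) ℂ) ×
      GaugeConfig 3 L (Matrix.specialUnitaryGroup (Fin 2) ℂ) =>
      (Real.sqrt (u p.1) - Real.sqrt (u p.2)) * (Real.sqrt (u p.1) - Real.sqrt (u p.2))) (μ ⊗ₘ κ h) :=
    Integrable.of_bound hcs.measurable.aestronglyMeasurable ((Ms + Ms) * (Ms + Ms)) (ae_of_all _ fun p => by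
      rw [Real.norm_eq_abs, abs_mul]
      have h1 : |Real.sqrt (u p.1) - Real.sqrt (u p.2)| ≤ Ms + Ms := (abs_sub _ _).trans (add_le_add (hMs _) (hMs _))
      exact mul_le_mul h1 h1 (abs_nonneg _) (le_trans (abs_nonneg _) h1))
  have hil : Integrable (fun p : GaugeConfig 3 L (Matrix.specialUnitaryGroup (Fin 2) ℂ) ×
      GaugeConfig 3 L (Matrix.specialUnitaryGroup (Fin 2) ℂ) => (u p.1 - u p.2) * (Real.log (u p.1) - Real.log (u p.2)))
      (μ ⊗ₘ κ h) :=
    Integrable.of_bound hcl.measurable.aestronglyMeasurable ((Mu + Mu) * (Ml + Ml)) (ae_of_all _ fun p => by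
      rw [Real.norm_eq_abs, abs_mul]
      have h1 : |u p.1 - u p.2| ≤ Mu + Mu := (abs_sub _ _).trans (add_le_add (hMu _) (hMu _))
      have h2 : |Real.log (u p.1) - Real.log (u p.2)| ≤ Ml + Ml := (abs_sub _ _).trans (add_le_add (hMl _) (hMl _))
      exact mul_le_mul h1 h2 (abs_nonneg _) (le_trans (abs_nonneg _) h1))
  have hmono : (∫ p, (Real.sqrt (u p.1) - Real.sqrt (u p.2)) * (Real.sqrt (u p.1) - Real.sqrt (u p.2)) ∂(μ ⊗ₘ κ h)) * 4 ≤
      ∫ p, (u p.1 - u p.2) * (Real.log (u p.1) - Real.log (u p.2)) ∂(μ ⊗ₘ κ h) := by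
    rw [← integral_mul_const]
    refine integral_mono (his.mul_const 4) hil fun p => ?_
    have := Literature.Probability.MarkovChains.four_mul_sq_sqrt_sub_le (hpos p.1) (hpos p.2)
    simp only [] at this ⊢
    nlinarith [this]
  linarith

/-! ## §3. Gibbs' inequality along the semigroup and the scale-`h` entropy production inequality -/

/-- ★ **Gibbs' step**: for continuous `u > 0`, `Ent_μ(κ_h u) − Ent_μ(u) ≤ ∫ (κ_h u − u) log(κ_h u) dμ_{β'}`, where
`Ent_μ(w) = ∫ w log w dμ − (∫ w dμ) log(∫ w dμ)` and `∫ κ_h u dμ = ∫ u dμ` (invariance, SZZ Lemma 3.3): Gibbs' inequality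
`∫ u log κ_h u ≤ ∫ u log u`. [cite: ShenZhuZhu2022, §3 Lemma 3.3 (p. 13)] -/
theorem entropy_transition_sub_entropy_le (L : ℕ) [NeZero L] (β' : ℝ)
    (κ : ℝ≥0 → Kernel (GaugeConfig 3 L (Matrix.specialUnitaryGroup (Fin 2) ℂ))
      (GaugeConfig 3 L (Matrix.specialUnitaryGroup (Fin 2) ℂ))) [∀ t, IsMarkovKernel (κ t)]
    (hreal : ∀ (t : ℝ≥0) (x : GaugeConfig 3 L (Matrix.specialUnitaryGroup (Fin 2) ℂ))
        (Ω : Type) [MeasurableSpace Ω] (P : Measure Ω) [IsProbabilityMeasure P]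
        (W : ℝ≥0 → Ω → (Edge 3 L × NoiseIdx 2 → ℝ)) (hW : IsFlatBrownian W P)
        (U : ℝ≥0 → Ω → GaugeConfig 3 L (Matrix.specialUnitaryGroup (Fin 2) ℂ)),
        (∀ ω, U 0 ω = x) →
        (latticeLangevinDynamics (fundamentalLatticeRep 2) β').IsSolution (fundamentalRep (Fin 2))
          hW.natFiltration P W U →
        κ t x = P.map (U t))
    (h : ℝ≥0) {u : GaugeConfig 3 L (Matrix.specialUnitaryGroup (Fin 2) ℂ) → ℝ} (hu : Continuous u) (hpos : ∀ x, 0 < u x) :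
    ((∫ x, (∫ y, u y ∂(κ h x)) * Real.log (∫ y, u y ∂(κ h x)) ∂(wilsonMeasure (d := 3) (L := L) (fundamentalRep (Fin 2)) β')) -
        (∫ x, (∫ y, u y ∂(κ h x)) ∂(wilsonMeasure (d := 3) (L := L) (fundamentalRep (Fin 2)) β')) *
          Real.log (∫ x, (∫ y, u y ∂(κ h x)) ∂(wilsonMeasure (d := 3) (L := L) (fundamentalRep (Fin 2)) β'))) -
      ((∫ x, u x * Real.log (u x) ∂(wilsonMeasure (d := 3) (L := L) (fundamentalRep (Fin 2)) β')) -
        (∫ x, u x ∂(wilsonMeasure (d := 3) (L := L) (fundamentalRep (Fin 2)) β')) *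
          Real.log (∫ x, u x ∂(wilsonMeasure (d := 3) (L := L) (fundamentalRep (Fin 2)) β'))) ≤
      ∫ x, ((∫ y, u y ∂(κ h x)) - u x) * Real.log (∫ y, u y ∂(κ h x))
        ∂(wilsonMeasure (d := 3) (L := L) (fundamentalRep (Fin 2)) β') := by
  classical
  haveI := secondCountableTopology_su2
  haveI := borelSpace_config L
  set μ : Measure (GaugeConfig 3 L (Matrix.specialUnitaryGroup (Fin 2) ℂ)) :=
    wilsonMeasure (d := 3) (L := L) (fundamentalRep (Fin 2)) β' with hμ
  haveI : IsProbabilityMeasure μ :=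
    isProbabilityMeasure_wilsonMeasure (d := 3) (L := L) (fundamentalRep (Fin 2)) (continuous_fundamentalRep (Fin 2)) β'
  -- `v = κ_h u` is continuous and positive
  set v : GaugeConfig 3 L (Matrix.specialUnitaryGroup (Fin 2) ℂ) → ℝ := fun x => ∫ y, u y ∂(κ h x) with hv
  have hvc : Continuous v := continuous_integral_transitionKernel L β' κ hreal h hu
  obtain ⟨δ, hδ, hδle⟩ := exists_pos_le_of_continuous_of_compactSpace hu hpos
  have hvpos : ∀ x, 0 < v x := by
    intro x
    have h1 : δ ≤ ∫ y, u y ∂(κ h x) := by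
      have := integral_mono (integrable_const (μ := κ h x) δ) (integrable_of_continuous_of_compactSpace hu _) fun y => hδle y
      rwa [integral_const, probReal_univ, one_smul] at this
    exact lt_of_lt_of_le hδ h1
  obtain ⟨Mu, -, hMu⟩ := exists_abs_le_of_continuous hu
  -- invariance: `∫ v dμ = ∫ u dμ`
  have hmass : ∫ x, v x ∂μ = ∫ x, u x ∂μ :=
    integral_transitionKernel_integral_eq_wilson (L := L) β' κ hreal h hu.measurable ⟨Mu, hMu⟩
  have hlogv : Continuous fun x => Real.log (v x) := hvc.log fun x => (hvpos x).ne'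
  have hlogu : Continuous fun x => Real.log (u x) := hu.log fun x => (hpos x).ne'
  -- Gibbs
  have iulv : Integrable (fun x => u x * Real.log (v x)) μ := integrable_of_continuous_of_compactSpace (hu.mul hlogv) _
  have iulu : Integrable (fun x => u x * Real.log (u x)) μ := integrable_of_continuous_of_compactSpace (hu.mul hlogu) _
  have ivlv : Integrable (fun x => v x * Real.log (v x)) μ := integrable_of_continuous_of_compactSpace (hvc.mul hlogv) _
  have hG := EntropyFlow.integral_mul_log_le_integral_mul_log (ν := μ) (fun x => (hpos x).le) hvpos
    (integrable_of_continuous_of_compactSpace hu _) (integrable_of_continuous_of_compactSpace hvc _) iulv iulu hmass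
  have e : ∫ x, (v x - u x) * Real.log (v x) ∂μ = (∫ x, v x * Real.log (v x) ∂μ) - ∫ x, u x * Real.log (v x) ∂μ := by
    rw [← integral_sub ivlv iulv]
    refine integral_congr_ae (Eventually.of_forall fun x => ?_)
    ring
  change ((∫ x, v x * Real.log (v x) ∂μ) - (∫ x, v x ∂μ) * Real.log (∫ x, v x ∂μ)) -
      ((∫ x, u x * Real.log (u x) ∂μ) - (∫ x, u x ∂μ) * Real.log (∫ x, u x ∂μ)) ≤ ∫ x, (v x - u x) * Real.log (v x) ∂μ
  rw [e, hmass]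
  linarith

/-- ★★ **The scale-`h` entropy production inequality.**  For continuous `u` with `δ ≤ u` (`δ > 0`), any realising kernel
family and any `h`, if `|κ_h u − u| ≤ D` pointwise then
`Ent_μ(κ_h u) − Ent_μ(u) ≤ −4 (∫ u dμ − ∫ √u κ_h√u dμ) + D²/δ`
(`= −4h 𝓔_h(√u) + D²/δ`; Gibbs' step, the split `log κ_h u = log u + (log κ_h u − log u)`, `four_mul_dirichletScale_sqrt_le`,
and `(a − b)(log a − log b) ≤ (a − b)²/δ`, the tree's `Literature.Probability.MarkovChains.sub_mul_log_sub_le`). [cite: BakryGentilLedoux2014, Thm 5.2.1 (proof)] -/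
theorem entropy_transition_sub_entropy_le_dirichletScale (L : ℕ) [NeZero L] (β' : ℝ)
    (κ : ℝ≥0 → Kernel (GaugeConfig 3 L (Matrix.specialUnitaryGroup (Fin 2) ℂ))
      (GaugeConfig 3 L (Matrix.specialUnitaryGroup (Fin 2) ℂ))) [∀ t, IsMarkovKernel (κ t)]
    (hreal : ∀ (t : ℝ≥0) (x : GaugeConfig 3 L (Matrix.specialUnitaryGroup (Fin 2) ℂ))
        (Ω : Type) [MeasurableSpace Ω] (P : Measure Ω) [IsProbabilityMeasure P]
        (W : ℝ≥0 → Ω → (Edge 3 L × NoiseIdx 2 → ℝ)) (hW : IsFlatBrownian W P)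
        (U : ℝ≥0 → Ω → GaugeConfig 3 L (Matrix.specialUnitaryGroup (Fin 2) ℂ)),
        (∀ ω, U 0 ω = x) →
        (latticeLangevinDynamics (fundamentalLatticeRep 2) β').IsSolution (fundamentalRep (Fin 2))
          hW.natFiltration P W U →
        κ t x = P.map (U t))
    (h : ℝ≥0) {u : GaugeConfig 3 L (Matrix.specialUnitaryGroup (Fin 2) ℂ) → ℝ} (hu : Continuous u)
    {δ : ℝ} (hδ : 0 < δ) (hδu : ∀ x, δ ≤ u x) {D : ℝ} (hD : ∀ x, |(∫ y, u y ∂(κ h x)) - u x| ≤ D) :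
    ((∫ x, (∫ y, u y ∂(κ h x)) * Real.log (∫ y, u y ∂(κ h x)) ∂(wilsonMeasure (d := 3) (L := L) (fundamentalRep (Fin 2)) β')) -
        (∫ x, (∫ y, u y ∂(κ h x)) ∂(wilsonMeasure (d := 3) (L := L) (fundamentalRep (Fin 2)) β')) *
          Real.log (∫ x, (∫ y, u y ∂(κ h x)) ∂(wilsonMeasure (d := 3) (L := L) (fundamentalRep (Fin 2)) β'))) -
      ((∫ x, u x * Real.log (u x) ∂(wilsonMeasure (d := 3) (L := L) (fundamentalRep (Fin 2)) β')) -
        (∫ x, u x ∂(wilsonMeasure (d := 3) (L := L) (fundamentalRep (Fin 2)) β')) *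
          Real.log (∫ x, u x ∂(wilsonMeasure (d := 3) (L := L) (fundamentalRep (Fin 2)) β'))) ≤
      -4 * ((∫ x, Real.sqrt (u x) * Real.sqrt (u x) ∂(wilsonMeasure (d := 3) (L := L) (fundamentalRep (Fin 2)) β')) -
        ∫ x, Real.sqrt (u x) * (∫ y, Real.sqrt (u y) ∂(κ h x)) ∂(wilsonMeasure (d := 3) (L := L) (fundamentalRep (Fin 2)) β')) +
      D ^ 2 / δ := by
  classical
  haveI := secondCountableTopology_su2
  haveI := borelSpace_config L
  set μ : Measure (GaugeConfig 3 L (Matrix.specialUnitaryGroup (Fin 2) ℂ)) :=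
    wilsonMeasure (d := 3) (L := L) (fundamentalRep (Fin 2)) β' with hμ
  haveI : IsProbabilityMeasure μ :=
    isProbabilityMeasure_wilsonMeasure (d := 3) (L := L) (fundamentalRep (Fin 2)) (continuous_fundamentalRep (Fin 2)) β'
  have hpos : ∀ x, 0 < u x := fun x => lt_of_lt_of_le hδ (hδu x)
  set v : GaugeConfig 3 L (Matrix.specialUnitaryGroup (Fin 2) ℂ) → ℝ := fun x => ∫ y, u y ∂(κ h x) with hv
  have hvc : Continuous v := continuous_integral_transitionKernel L β' κ hreal h hu
  have hδv : ∀ x, δ ≤ v x := by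
    intro x
    have := integral_mono (integrable_const (μ := κ h x) δ) (integrable_of_continuous_of_compactSpace hu _) fun y => hδu y
    rwa [integral_const, probReal_univ, one_smul] at this
  have hvpos : ∀ x, 0 < v x := fun x => lt_of_lt_of_le hδ (hδv x)
  have hlogv : Continuous fun x => Real.log (v x) := hvc.log fun x => (hvpos x).ne'
  have hlogu : Continuous fun x => Real.log (u x) := hu.log fun x => (hpos x).ne'
  -- Gibbs' step
  have h1 := entropy_transition_sub_entropy_le L β' κ hreal h hu hpos
  -- split `log v = log u + (log v − log u)`
  have i1 : Integrable (fun x => (v x - u x) * Real.log (u x)) μ :=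
    integrable_of_continuous_of_compactSpace ((hvc.sub hu).mul hlogu) _
  have i2 : Integrable (fun x => (v x - u x) * (Real.log (v x) - Real.log (u x))) μ :=
    integrable_of_continuous_of_compactSpace ((hvc.sub hu).mul (hlogv.sub hlogu)) _
  have hsplit : ∫ x, (v x - u x) * Real.log (v x) ∂μ =
      (∫ x, (v x - u x) * Real.log (u x) ∂μ) + ∫ x, (v x - u x) * (Real.log (v x) - Real.log (u x)) ∂μ := by
    rw [← integral_add i1 i2]
    refine integral_congr_ae (Eventually.of_forall fun x => ?_)
    ring
  -- first piece: `∫ (v − u) log u = −(∫ u log u − ∫ log u · v) ≤ −4 h𝓔_h(√u)`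
  have h2 := four_mul_dirichletScale_sqrt_le L β' κ hreal h hu hpos
  have e2 : ∫ x, (v x - u x) * Real.log (u x) ∂μ =
      -((∫ x, u x * Real.log (u x) ∂μ) - ∫ x, Real.log (u x) * v x ∂μ) := by
    have ee : ∀ x, (v x - u x) * Real.log (u x) = Real.log (u x) * v x - u x * Real.log (u x) := fun x => by ring
    simp_rw [ee]
    have ia : Integrable (fun x => Real.log (u x) * v x) μ := integrable_of_continuous_of_compactSpace (hlogu.mul hvc) _
    have ib : Integrable (fun x => u x * Real.log (u x)) μ := integrable_of_continuous_of_compactSpace (hu.mul hlogu) _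
    rw [integral_sub ia ib]
    ring
  -- second piece: `≤ D²/δ`
  have h3 : ∫ x, (v x - u x) * (Real.log (v x) - Real.log (u x)) ∂μ ≤ D ^ 2 / δ := by
    have hpt : ∀ x, (v x - u x) * (Real.log (v x) - Real.log (u x)) ≤ D ^ 2 / δ := by
      intro x
      have ha := hD x
      have hb := Literature.Probability.MarkovChains.sub_mul_log_sub_le hδ (hδv x) (hδu x)
      have hsq : (v x - u x) ^ 2 ≤ D ^ 2 := by
        rw [← sq_abs (v x - u x)]
        exact pow_le_pow_left₀ (abs_nonneg _) ha 2
      exact hb.trans (div_le_div_of_nonneg_right hsq hδ.le)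
    have := integral_mono i2 (integrable_const (D ^ 2 / δ)) hpt
    rwa [integral_const, probReal_univ, one_smul] at this
  have h4 : ∫ x, (v x - u x) * Real.log (v x) ∂μ ≤
      -4 * ((∫ x, Real.sqrt (u x) * Real.sqrt (u x) ∂μ) - ∫ x, Real.sqrt (u x) * (∫ y, Real.sqrt (u y) ∂(κ h x)) ∂μ) +
        D ^ 2 / δ := by
    rw [hsplit, e2]
    linarith
  exact h1.trans h4

end Summit.QuantumFields.YangMills.Theorems.ColdStartUniversality

end
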